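import Summits.ValiantsHypothesis.ValiantsHypothesis.Theorems.DivisionGapZeroOneTransferStubFormulaGridProjectionAux6

/-!
# Crux `DivisionGap.ZeroOneTransfer` (stmt-ValiantsHypothesis-5066), line `planar-dimer-sign-elimination` —
stub `stub_formulaGridProjection`, support file 7

support file 7: the parallel layout, part 1 — bookkeeping and the wired lower gadget

For the parallel composition `x • F + y • G` in the grid (data `parX`, `parW` of file 6):
`par_prelims` records where the frame-and-wire weight can be non-zero and its unit darts one type
at a time (everything is linear arithmetic on cell coordinates, discharged by `omega`), and
`par_wired` shows that under the total weight `parW` the two gadgets keep their two states and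
that the lower gadget extended by the two unit wires of the side columns (each a `twoState_path`,
joined by `twoState_series`) is a two-state gadget with ports the two wire tops.

Registered sub-goal proved here: `stub_formulaGridProjection_frameOffUpper` (the frame-and-wire
weight vanishes between two cells of the upper rectangle). [folklore]
-/

set_option linter.dupNamespace false

namespace Summit.ValiantsHypothesis.ValiantsHypothesis.Theorems.DivisionGapZeroOneTransfer

namespace FormulaGridProjection

open Finset MvPolynomial

/-- `TwoState⟦D, W, p, q, g⟧` (a LOCAL NOTATION, deliberately not a definition): a TWO-STATE GADGET on the
vertex set `D` with ports `p ≠ q` computing `g` — the whole of `D` has matching sum `g` ("active": both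
ports matched inside), `D ∖ {p, q}` has matching sum `1` ("inactive"), and `|D|` is even (so the two
mixed states have matching sum `0` by parity).  The two-attachment case of a gadget signature
(Valiant 1979 §2; DKLM 2010 §4.4). -/
local notation3 "TwoState⟦" D ", " W ", " p ", " q ", " g "⟧" =>
  p ∈ D ∧ q ∈ D ∧ p ≠ q ∧ Even (Finset.card D) ∧ msum D W = g ∧
    msum (Finset.erase (Finset.erase D p) q) W = 1


/-- `IsLab⟦x⟧` (local notation): `x` is literally a variable `X j` or a constant `C c` — the entries
allowed in a Valiant projection (`IsProjection`). -/
local notation3 "IsLab⟦" x "⟧" => (∃ j, x = MvPolynomial.X j) ∨ ∃ c, x = MvPolynomial.C c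

/-- `Adj⟦a, b⟧` (local notation): adjacency of the square grid on `ℕ × ℕ`, verbatim the four disjuncts
of the route's grid-dimer polynomial. -/
local notation3 "Adj⟦" a ", " b "⟧" =>
  (Prod.fst a + 1 = Prod.fst b ∧ Prod.snd a = Prod.snd b) ∨
    (Prod.fst b + 1 = Prod.fst a ∧ Prod.snd a = Prod.snd b) ∨
    (Prod.fst a = Prod.fst b ∧ Prod.snd a + 1 = Prod.snd b) ∨
    (Prod.fst a = Prod.fst b ∧ Prod.snd b + 1 = Prod.snd a)

/-- `box⟦r, c, h, w⟧` (local notation): the `h × w` rectangle of cells with top-left cell `(r, c)`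
(rows `r ≤ i < r + h`, columns `c ≤ j < c + w`). -/
local notation3 "box⟦" r ", " c ", " h ", " w "⟧" =>
  (Finset.Ico r (r + h) ×ˢ Finset.Ico c (c + w) : Finset (ℕ × ℕ))

/-- `Gad⟦W, r, c, h, w, g⟧` (local notation): `W` is a GRID GADGET for `g` on the rectangle
`box⟦r, c, h, w⟧` — every dart weight is a label, non-zero weights only on darts between adjacent
cells of the rectangle, and the rectangle is a two-state gadget computing `g` with ports its
top-left and top-right cells. -/
local notation3 "Gad⟦" W ", " r ", " c ", " h ", " w ", " g "⟧" =>
  (∀ a b, IsLab⟦W a b⟧) ∧ (∀ a b, W a b ≠ 0 → a ∈ box⟦r, c, h, w⟧ ∧ b ∈ box⟦r, c, h, w⟧ ∧ Adj⟦a, b⟧) ∧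
    TwoState⟦box⟦r, c, h, w⟧, W, (r, c), (r, c + w - 1), g⟧

section ParPrelims

variable {R : Type*} [CommSemiring R] {ι : Type*}

/-- Bookkeeping for the parallel layout: where the frame-and-wire weight `parX` can be non-zero,
its unit darts one type at a time, and the vanishing of the gadget weights off their rectangles.
[folklore] -/
theorem par_prelims {WF WG : ℕ × ℕ → ℕ × ℕ → MvPolynomial ι R} {r c hF hG m : ℕ}
    {x y : MvPolynomial ι R}
    (hsuppF : ∀ a b, WF a b ≠ 0 → a ∈ box⟦r + 1, c + 1, hF, m⟧ ∧ b ∈ box⟦r + 1, c + 1, hF, m⟧ ∧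
      Adj⟦a, b⟧)
    (hsuppG : ∀ a b, WG a b ≠ 0 → a ∈ box⟦r + 1 + hF, c + 1, hG, m⟧ ∧
      b ∈ box⟦r + 1 + hF, c + 1, hG, m⟧ ∧ Adj⟦a, b⟧) (h2F : 2 ≤ hF) (h2m : 2 ≤ m) :
    (∀ u v, parX r c hF m x y u v ≠ 0 →
      (u.1 = r ∧ u.2 = c ∧ v.1 = r ∧ v.2 = c + 1) ∨ (u.1 = r ∧ u.2 = c ∧ v.1 = r + 1 ∧ v.2 = c) ∨
      ((u.1 = r ∧ u.2 = c + 1 ∧ v.1 = r ∧ v.2 = c) ∨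
        (u.1 = r + 1 ∧ u.2 = c ∧ v.1 = r ∧ v.2 = c) ∨
        (u.1 = r ∧ v.1 = r ∧ ((u.2 = c + m + 1 ∧ v.2 = c + m) ∨ (u.2 = c + m ∧ v.2 = c + m + 1))) ∨
        (u.2 = c + m + 1 ∧ v.2 = c + m + 1 ∧ ((u.1 = r ∧ v.1 = r + 1) ∨ (u.1 = r + 1 ∧ v.1 = r))) ∨
        (u.2 = c + 1 ∧ v.2 = c + 1 ∧ ((u.1 = r ∧ v.1 = r + 1) ∨ (u.1 = r + 1 ∧ v.1 = r))) ∨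
        (u.2 = c + m ∧ v.2 = c + m ∧ ((u.1 = r ∧ v.1 = r + 1) ∨ (u.1 = r + 1 ∧ v.1 = r))) ∨
        (u.2 = c ∧ v.2 = c ∧ r + 1 ≤ u.1 ∧ r + 1 ≤ v.1 ∧ u.1 ≤ r + 1 + hF ∧ v.1 ≤ r + 1 + hF ∧
          (u.1 + 1 = v.1 ∨ v.1 + 1 = u.1)) ∨
        (u.2 = c + m + 1 ∧ v.2 = c + m + 1 ∧ r + 1 ≤ u.1 ∧ r + 1 ≤ v.1 ∧ u.1 ≤ r + 1 + hF ∧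
          v.1 ≤ r + 1 + hF ∧ (u.1 + 1 = v.1 ∨ v.1 + 1 = u.1)) ∨
        (u.1 = r + 1 + hF ∧ v.1 = r + 1 + hF ∧
          ((u.2 = c ∧ v.2 = c + 1) ∨ (u.2 = c + 1 ∧ v.2 = c))) ∨
        (u.1 = r + 1 + hF ∧ v.1 = r + 1 + hF ∧
          ((u.2 = c + m + 1 ∧ v.2 = c + m) ∨ (u.2 = c + m ∧ v.2 = c + m + 1))))) ∧
    (∀ u v, parX r c hF m x y u v ≠ 0 → u ∉ box⟦r + 1, c + 1, hF, m⟧ ∨ v ∉ box⟦r + 1, c + 1, hF, m⟧) ∧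
    (∀ u v, parX r c hF m x y u v ≠ 0 →
      u ∉ box⟦r + 1 + hF, c + 1, hG, m⟧ ∨ v ∉ box⟦r + 1 + hF, c + 1, hG, m⟧) ∧
    (∀ u v, u ∉ box⟦r + 1, c + 1, hF, m⟧ ∨ v ∉ box⟦r + 1, c + 1, hF, m⟧ → WF u v = 0) ∧
    (∀ u v, u ∉ box⟦r + 1 + hF, c + 1, hG, m⟧ ∨ v ∉ box⟦r + 1 + hF, c + 1, hG, m⟧ →
      WG u v = 0) ∧
    (∀ u v, u ∈ box⟦r + 1, c + 1, hF, m⟧ ∧ v ∈ box⟦r + 1, c + 1, hF, m⟧ ∨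
      u ∈ box⟦r + 1 + hF, c + 1, hG, m⟧ ∧ v ∈ box⟦r + 1 + hF, c + 1, hG, m⟧ → parX r c hF m x y u v = 0) ∧
    (∀ u v : ℕ × ℕ, (u.1 = r ∧ u.2 = c + 1 ∧ v.1 = r ∧ v.2 = c) → parX r c hF m x y u v = 1) ∧
    (∀ u v : ℕ × ℕ, (u.1 = r + 1 ∧ u.2 = c ∧ v.1 = r ∧ v.2 = c) → parX r c hF m x y u v = 1) ∧
    (∀ u v : ℕ × ℕ, (u.1 = r ∧ v.1 = r ∧ ((u.2 = c + m + 1 ∧ v.2 = c + m) ∨ (u.2 = c + m ∧ v.2 = c + m + 1))) → parX r c hF m x y u v = 1) ∧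
    (∀ u v : ℕ × ℕ, (u.2 = c + m + 1 ∧ v.2 = c + m + 1 ∧ ((u.1 = r ∧ v.1 = r + 1) ∨ (u.1 = r + 1 ∧ v.1 = r))) → parX r c hF m x y u v = 1) ∧
    (∀ u v : ℕ × ℕ, (u.2 = c + 1 ∧ v.2 = c + 1 ∧ ((u.1 = r ∧ v.1 = r + 1) ∨ (u.1 = r + 1 ∧ v.1 = r))) → parX r c hF m x y u v = 1) ∧
    (∀ u v : ℕ × ℕ, (u.2 = c + m ∧ v.2 = c + m ∧ ((u.1 = r ∧ v.1 = r + 1) ∨ (u.1 = r + 1 ∧ v.1 = r))) → parX r c hF m x y u v = 1) ∧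
    (∀ u v : ℕ × ℕ, (u.2 = c ∧ v.2 = c ∧ r + 1 ≤ u.1 ∧ r + 1 ≤ v.1 ∧ u.1 ≤ r + 1 + hF ∧ v.1 ≤ r + 1 + hF ∧
        (u.1 + 1 = v.1 ∨ v.1 + 1 = u.1)) → parX r c hF m x y u v = 1) ∧
    (∀ u v : ℕ × ℕ, (u.2 = c + m + 1 ∧ v.2 = c + m + 1 ∧ r + 1 ≤ u.1 ∧ r + 1 ≤ v.1 ∧ u.1 ≤ r + 1 + hF ∧
        v.1 ≤ r + 1 + hF ∧ (u.1 + 1 = v.1 ∨ v.1 + 1 = u.1)) → parX r c hF m x y u v = 1) ∧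
    (∀ u v : ℕ × ℕ, (u.1 = r + 1 + hF ∧ v.1 = r + 1 + hF ∧
        ((u.2 = c ∧ v.2 = c + 1) ∨ (u.2 = c + 1 ∧ v.2 = c))) → parX r c hF m x y u v = 1) ∧
    (∀ u v : ℕ × ℕ, (u.1 = r + 1 + hF ∧ v.1 = r + 1 + hF ∧
        ((u.2 = c + m + 1 ∧ v.2 = c + m) ∨ (u.2 = c + m ∧ v.2 = c + m + 1))) → parX r c hF m x y u v = 1) ∧
    (∀ u v, u.2 = c ∨ u.2 = c + m + 1 → parW WF WG r c hF m x y u v = parX r c hF m x y u v) := by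
  set X := parX r c hF m x y with hXd
  set W := parW WF WG r c hF m x y with hWd
  have hX : ∀ u v, X u v =
      if u.1 = r ∧ u.2 = c ∧ v.1 = r ∧ v.2 = c + 1 then x else
      if u.1 = r ∧ u.2 = c ∧ v.1 = r + 1 ∧ v.2 = c then y else
      if ((u.1 = r ∧ u.2 = c + 1 ∧ v.1 = r ∧ v.2 = c) ∨
        (u.1 = r + 1 ∧ u.2 = c ∧ v.1 = r ∧ v.2 = c) ∨
        (u.1 = r ∧ v.1 = r ∧ ((u.2 = c + m + 1 ∧ v.2 = c + m) ∨ (u.2 = c + m ∧ v.2 = c + m + 1))) ∨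
        (u.2 = c + m + 1 ∧ v.2 = c + m + 1 ∧ ((u.1 = r ∧ v.1 = r + 1) ∨ (u.1 = r + 1 ∧ v.1 = r))) ∨
        (u.2 = c + 1 ∧ v.2 = c + 1 ∧ ((u.1 = r ∧ v.1 = r + 1) ∨ (u.1 = r + 1 ∧ v.1 = r))) ∨
        (u.2 = c + m ∧ v.2 = c + m ∧ ((u.1 = r ∧ v.1 = r + 1) ∨ (u.1 = r + 1 ∧ v.1 = r))) ∨
        (u.2 = c ∧ v.2 = c ∧ r + 1 ≤ u.1 ∧ r + 1 ≤ v.1 ∧ u.1 ≤ r + 1 + hF ∧ v.1 ≤ r + 1 + hF ∧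
          (u.1 + 1 = v.1 ∨ v.1 + 1 = u.1)) ∨
        (u.2 = c + m + 1 ∧ v.2 = c + m + 1 ∧ r + 1 ≤ u.1 ∧ r + 1 ≤ v.1 ∧ u.1 ≤ r + 1 + hF ∧
          v.1 ≤ r + 1 + hF ∧ (u.1 + 1 = v.1 ∨ v.1 + 1 = u.1)) ∨
        (u.1 = r + 1 + hF ∧ v.1 = r + 1 + hF ∧
          ((u.2 = c ∧ v.2 = c + 1) ∨ (u.2 = c + 1 ∧ v.2 = c))) ∨
        (u.1 = r + 1 + hF ∧ v.1 = r + 1 + hF ∧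
          ((u.2 = c + m + 1 ∧ v.2 = c + m) ∨ (u.2 = c + m ∧ v.2 = c + m + 1)))) then 1 else 0 := fun u v => by rw [hXd]; exact parX_apply r c hF m x y u v
  have hW : ∀ u v, W u v = WF u v + WG u v + X u v := fun u v => rfl
  -- where `X` may be non-zero
  have hXS : ∀ u v, X u v ≠ 0 →
      (u.1 = r ∧ u.2 = c ∧ v.1 = r ∧ v.2 = c + 1) ∨ (u.1 = r ∧ u.2 = c ∧ v.1 = r + 1 ∧ v.2 = c) ∨
      ((u.1 = r ∧ u.2 = c + 1 ∧ v.1 = r ∧ v.2 = c) ∨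
        (u.1 = r + 1 ∧ u.2 = c ∧ v.1 = r ∧ v.2 = c) ∨
        (u.1 = r ∧ v.1 = r ∧ ((u.2 = c + m + 1 ∧ v.2 = c + m) ∨ (u.2 = c + m ∧ v.2 = c + m + 1))) ∨
        (u.2 = c + m + 1 ∧ v.2 = c + m + 1 ∧ ((u.1 = r ∧ v.1 = r + 1) ∨ (u.1 = r + 1 ∧ v.1 = r))) ∨
        (u.2 = c + 1 ∧ v.2 = c + 1 ∧ ((u.1 = r ∧ v.1 = r + 1) ∨ (u.1 = r + 1 ∧ v.1 = r))) ∨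
        (u.2 = c + m ∧ v.2 = c + m ∧ ((u.1 = r ∧ v.1 = r + 1) ∨ (u.1 = r + 1 ∧ v.1 = r))) ∨
        (u.2 = c ∧ v.2 = c ∧ r + 1 ≤ u.1 ∧ r + 1 ≤ v.1 ∧ u.1 ≤ r + 1 + hF ∧ v.1 ≤ r + 1 + hF ∧
          (u.1 + 1 = v.1 ∨ v.1 + 1 = u.1)) ∨
        (u.2 = c + m + 1 ∧ v.2 = c + m + 1 ∧ r + 1 ≤ u.1 ∧ r + 1 ≤ v.1 ∧ u.1 ≤ r + 1 + hF ∧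
          v.1 ≤ r + 1 + hF ∧ (u.1 + 1 = v.1 ∨ v.1 + 1 = u.1)) ∨
        (u.1 = r + 1 + hF ∧ v.1 = r + 1 + hF ∧
          ((u.2 = c ∧ v.2 = c + 1) ∨ (u.2 = c + 1 ∧ v.2 = c))) ∨
        (u.1 = r + 1 + hF ∧ v.1 = r + 1 + hF ∧
          ((u.2 = c + m + 1 ∧ v.2 = c + m) ∨ (u.2 = c + m ∧ v.2 = c + m + 1)))) := by
    intro u v h
    rw [hX] at h
    split_ifs at h with h1 h2 h3
    · exact Or.inl h1
    · exact Or.inr (Or.inl h2)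
    · exact Or.inr (Or.inr h3)
    · exact absurd rfl h
  -- an `X`-dart always has an end outside each of the two boxes
  have hXF : ∀ u v, X u v ≠ 0 → u ∉ box⟦r + 1, c + 1, hF, m⟧ ∨ v ∉ box⟦r + 1, c + 1, hF, m⟧ := by
    intro u v h
    have := hXS u v h
    rw [mem_box, mem_box]
    omega
  have hXG : ∀ u v, X u v ≠ 0 →
      u ∉ box⟦r + 1 + hF, c + 1, hG, m⟧ ∨ v ∉ box⟦r + 1 + hF, c + 1, hG, m⟧ := by
    intro u v h
    have := hXS u v h
    rw [mem_box, mem_box]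
    omega
  have zF : ∀ u v, u ∉ box⟦r + 1, c + 1, hF, m⟧ ∨ v ∉ box⟦r + 1, c + 1, hF, m⟧ → WF u v = 0 :=
    fun u v h => by
    by_contra hne
    obtain ⟨hu, hv, -⟩ := hsuppF u v hne
    rcases h with h | h
    exacts [h hu, h hv]
  have zG : ∀ u v, u ∉ box⟦r + 1 + hF, c + 1, hG, m⟧ ∨ v ∉ box⟦r + 1 + hF, c + 1, hG, m⟧ →
      WG u v = 0 := fun u v h => by
    by_contra hne
    obtain ⟨hu, hv, -⟩ := hsuppG u v hne
    rcases h with h | h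
    exacts [h hu, h hv]
  have zX : ∀ u v, u ∈ box⟦r + 1, c + 1, hF, m⟧ ∧ v ∈ box⟦r + 1, c + 1, hF, m⟧ ∨
      u ∈ box⟦r + 1 + hF, c + 1, hG, m⟧ ∧ v ∈ box⟦r + 1 + hF, c + 1, hG, m⟧ → X u v = 0 := by
    intro u v h
    by_contra hne
    rcases h with ⟨hu, hv⟩ | ⟨hu, hv⟩
    · rcases hXF u v hne with h' | h'
      exacts [h' hu, h' hv]
    · rcases hXG u v hne with h' | h'
      exacts [h' hu, h' hv]
  -- value of `X` on a dart known to be unit: one lemma per type of unit dart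
  have hX1 : ∀ u v, ¬(u.1 = r ∧ u.2 = c ∧ v.1 = r ∧ v.2 = c + 1) →
      ¬(u.1 = r ∧ u.2 = c ∧ v.1 = r + 1 ∧ v.2 = c) → ((u.1 = r ∧ u.2 = c + 1 ∧ v.1 = r ∧ v.2 = c) ∨
        (u.1 = r + 1 ∧ u.2 = c ∧ v.1 = r ∧ v.2 = c) ∨
        (u.1 = r ∧ v.1 = r ∧ ((u.2 = c + m + 1 ∧ v.2 = c + m) ∨ (u.2 = c + m ∧ v.2 = c + m + 1))) ∨
        (u.2 = c + m + 1 ∧ v.2 = c + m + 1 ∧ ((u.1 = r ∧ v.1 = r + 1) ∨ (u.1 = r + 1 ∧ v.1 = r))) ∨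
        (u.2 = c + 1 ∧ v.2 = c + 1 ∧ ((u.1 = r ∧ v.1 = r + 1) ∨ (u.1 = r + 1 ∧ v.1 = r))) ∨
        (u.2 = c + m ∧ v.2 = c + m ∧ ((u.1 = r ∧ v.1 = r + 1) ∨ (u.1 = r + 1 ∧ v.1 = r))) ∨
        (u.2 = c ∧ v.2 = c ∧ r + 1 ≤ u.1 ∧ r + 1 ≤ v.1 ∧ u.1 ≤ r + 1 + hF ∧ v.1 ≤ r + 1 + hF ∧
          (u.1 + 1 = v.1 ∨ v.1 + 1 = u.1)) ∨
        (u.2 = c + m + 1 ∧ v.2 = c + m + 1 ∧ r + 1 ≤ u.1 ∧ r + 1 ≤ v.1 ∧ u.1 ≤ r + 1 + hF ∧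
          v.1 ≤ r + 1 + hF ∧ (u.1 + 1 = v.1 ∨ v.1 + 1 = u.1)) ∨
        (u.1 = r + 1 + hF ∧ v.1 = r + 1 + hF ∧
          ((u.2 = c ∧ v.2 = c + 1) ∨ (u.2 = c + 1 ∧ v.2 = c))) ∨
        (u.1 = r + 1 + hF ∧ v.1 = r + 1 + hF ∧
          ((u.2 = c + m + 1 ∧ v.2 = c + m) ∨ (u.2 = c + m ∧ v.2 = c + m + 1)))) → X u v = 1 := by
    intro u v h1 h2 h3
    rw [hX, if_neg h1, if_neg h2, if_pos h3]
  have X1 : ∀ u v : ℕ × ℕ, (u.1 = r ∧ u.2 = c + 1 ∧ v.1 = r ∧ v.2 = c) → X u v = 1 :=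
    fun u v h => hX1 u v (by omega) (by omega) (Or.inl h)
  have X2 : ∀ u v : ℕ × ℕ, (u.1 = r + 1 ∧ u.2 = c ∧ v.1 = r ∧ v.2 = c) → X u v = 1 :=
    fun u v h => hX1 u v (by omega) (by omega) (Or.inr (Or.inl h))
  have X3 : ∀ u v : ℕ × ℕ, (u.1 = r ∧ v.1 = r ∧ ((u.2 = c + m + 1 ∧ v.2 = c + m) ∨ (u.2 = c + m ∧ v.2 = c + m + 1))) → X u v = 1 :=
    fun u v h => hX1 u v (by omega) (by omega) (Or.inr (Or.inr (Or.inl h)))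
  have X4 : ∀ u v : ℕ × ℕ, (u.2 = c + m + 1 ∧ v.2 = c + m + 1 ∧ ((u.1 = r ∧ v.1 = r + 1) ∨ (u.1 = r + 1 ∧ v.1 = r))) → X u v = 1 :=
    fun u v h => hX1 u v (by omega) (by omega) (Or.inr (Or.inr (Or.inr (Or.inl h))))
  have X5 : ∀ u v : ℕ × ℕ, (u.2 = c + 1 ∧ v.2 = c + 1 ∧ ((u.1 = r ∧ v.1 = r + 1) ∨ (u.1 = r + 1 ∧ v.1 = r))) → X u v = 1 :=
    fun u v h => hX1 u v (by omega) (by omega) (Or.inr (Or.inr (Or.inr (Or.inr (Or.inl h)))))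
  have X6 : ∀ u v : ℕ × ℕ, (u.2 = c + m ∧ v.2 = c + m ∧ ((u.1 = r ∧ v.1 = r + 1) ∨ (u.1 = r + 1 ∧ v.1 = r))) → X u v = 1 :=
    fun u v h => hX1 u v (by omega) (by omega) (Or.inr (Or.inr (Or.inr (Or.inr (Or.inr (Or.inl h))))))
  have X7 : ∀ u v : ℕ × ℕ, (u.2 = c ∧ v.2 = c ∧ r + 1 ≤ u.1 ∧ r + 1 ≤ v.1 ∧ u.1 ≤ r + 1 + hF ∧ v.1 ≤ r + 1 + hF ∧
        (u.1 + 1 = v.1 ∨ v.1 + 1 = u.1)) → X u v = 1 :=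
    fun u v h => hX1 u v (by omega) (by omega) (Or.inr (Or.inr (Or.inr (Or.inr (Or.inr (Or.inr (Or.inl h)))))))
  have X8 : ∀ u v : ℕ × ℕ, (u.2 = c + m + 1 ∧ v.2 = c + m + 1 ∧ r + 1 ≤ u.1 ∧ r + 1 ≤ v.1 ∧ u.1 ≤ r + 1 + hF ∧
        v.1 ≤ r + 1 + hF ∧ (u.1 + 1 = v.1 ∨ v.1 + 1 = u.1)) → X u v = 1 :=
    fun u v h => hX1 u v (by omega) (by omega) (Or.inr (Or.inr (Or.inr (Or.inr (Or.inr (Or.inr (Or.inr (Or.inl h))))))))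
  have X9 : ∀ u v : ℕ × ℕ, (u.1 = r + 1 + hF ∧ v.1 = r + 1 + hF ∧
        ((u.2 = c ∧ v.2 = c + 1) ∨ (u.2 = c + 1 ∧ v.2 = c))) → X u v = 1 :=
    fun u v h => hX1 u v (by omega) (by omega) (Or.inr (Or.inr (Or.inr (Or.inr (Or.inr (Or.inr (Or.inr (Or.inr (Or.inl h)))))))))
  have X10 : ∀ u v : ℕ × ℕ, (u.1 = r + 1 + hF ∧ v.1 = r + 1 + hF ∧
        ((u.2 = c + m + 1 ∧ v.2 = c + m) ∨ (u.2 = c + m ∧ v.2 = c + m + 1))) → X u v = 1 :=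
    fun u v h => hX1 u v (by omega) (by omega) (Or.inr (Or.inr (Or.inr (Or.inr (Or.inr (Or.inr (Or.inr (Or.inr (Or.inr h)))))))))
  have hWside : ∀ u v, u.2 = c ∨ u.2 = c + m + 1 → W u v = X u v := by
    intro u v hu
    rw [hW, zF u v (Or.inl (by rw [mem_box]; omega)), zG u v (Or.inl (by rw [mem_box]; omega)),
      zero_add, zero_add]
  exact ⟨hXS, hXF, hXG, zF, zG, zX, X1, X2, X3, X4, X5, X6, X7, X8, X9, X10, hWside⟩

end ParPrelims

section ParWired

variable {R : Type*} [CommSemiring R] {ι : Type*}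

/-- The two gadgets under the total weight `parW`, and the lower gadget extended by the two unit
wires of the side columns (`twoState_path` twice, `twoState_series` twice). [folklore] -/
theorem par_wired {WF WG : ℕ × ℕ → ℕ × ℕ → MvPolynomial ι R} {r c hF hG m : ℕ}
    {gF gG x y : MvPolynomial ι R} (hGF : Gad⟦WF, r + 1, c + 1, hF, m, gF⟧)
    (hGG : Gad⟦WG, r + 1 + hF, c + 1, hG, m, gG⟧)
    (ehF : Even hF) (ehG : Even hG) (em : Even m) (h2F : 2 ≤ hF) (h2m : 2 ≤ m) :
    TwoState⟦box⟦r + 1, c + 1, hF, m⟧, parW WF WG r c hF m x y, (r + 1, c + 1),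
      (r + 1, c + 1 + m - 1), gF⟧ ∧
    TwoState⟦(box⟦r + 2, c, hF, 1⟧ ∪ box⟦r + 1 + hF, c + 1, hG, m⟧) ∪ box⟦r + 2, c + m + 1, hF, 1⟧,
      parW WF WG r c hF m x y, (r + 2, c), (r + 2, c + m + 1), 1 * gG * 1⟧ := by
  obtain ⟨hlabF, hsuppF, hTF⟩ := hGF
  obtain ⟨hlabG, hsuppG, hTG⟩ := hGG
  obtain ⟨kF, hkF⟩ := ehF
  obtain ⟨kG, hkG⟩ := ehG
  obtain ⟨km, hkm⟩ := em
  obtain ⟨hXS, hXF, hXG, zF, zG, zX, X1, X2, X3, X4, X5, X6, X7, X8, X9, X10, hWside⟩ :=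
    par_prelims (x := x) (y := y) (hG := hG) hsuppF hsuppG h2F h2m
  set X := parX r c hF m x y with hXd
  set W := parW WF WG r c hF m x y with hWd
  have hX : ∀ u v, X u v =
      if u.1 = r ∧ u.2 = c ∧ v.1 = r ∧ v.2 = c + 1 then x else
      if u.1 = r ∧ u.2 = c ∧ v.1 = r + 1 ∧ v.2 = c then y else
      if ((u.1 = r ∧ u.2 = c + 1 ∧ v.1 = r ∧ v.2 = c) ∨
        (u.1 = r + 1 ∧ u.2 = c ∧ v.1 = r ∧ v.2 = c) ∨
        (u.1 = r ∧ v.1 = r ∧ ((u.2 = c + m + 1 ∧ v.2 = c + m) ∨ (u.2 = c + m ∧ v.2 = c + m + 1))) ∨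
        (u.2 = c + m + 1 ∧ v.2 = c + m + 1 ∧ ((u.1 = r ∧ v.1 = r + 1) ∨ (u.1 = r + 1 ∧ v.1 = r))) ∨
        (u.2 = c + 1 ∧ v.2 = c + 1 ∧ ((u.1 = r ∧ v.1 = r + 1) ∨ (u.1 = r + 1 ∧ v.1 = r))) ∨
        (u.2 = c + m ∧ v.2 = c + m ∧ ((u.1 = r ∧ v.1 = r + 1) ∨ (u.1 = r + 1 ∧ v.1 = r))) ∨
        (u.2 = c ∧ v.2 = c ∧ r + 1 ≤ u.1 ∧ r + 1 ≤ v.1 ∧ u.1 ≤ r + 1 + hF ∧ v.1 ≤ r + 1 + hF ∧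
          (u.1 + 1 = v.1 ∨ v.1 + 1 = u.1)) ∨
        (u.2 = c + m + 1 ∧ v.2 = c + m + 1 ∧ r + 1 ≤ u.1 ∧ r + 1 ≤ v.1 ∧ u.1 ≤ r + 1 + hF ∧
          v.1 ≤ r + 1 + hF ∧ (u.1 + 1 = v.1 ∨ v.1 + 1 = u.1)) ∨
        (u.1 = r + 1 + hF ∧ v.1 = r + 1 + hF ∧
          ((u.2 = c ∧ v.2 = c + 1) ∨ (u.2 = c + 1 ∧ v.2 = c))) ∨
        (u.1 = r + 1 + hF ∧ v.1 = r + 1 + hF ∧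
          ((u.2 = c + m + 1 ∧ v.2 = c + m) ∨ (u.2 = c + m ∧ v.2 = c + m + 1)))) then 1 else 0 := fun u v => by rw [hXd]; exact parX_apply r c hF m x y u v
  have hW : ∀ u v, W u v = WF u v + WG u v + X u v := fun u v => rfl
  -- `W` restricted to the two boxes, and the two gadgets under `W`
  have hTF' : TwoState⟦box⟦r + 1, c + 1, hF, m⟧, W, (r + 1, c + 1), (r + 1, c + 1 + m - 1), gF⟧ := by
    refine twoState_congr (fun a ha b hb => ?_) hTF
    rw [hW, zG a b (Or.inl ?_), zX a b (Or.inl ⟨ha, hb⟩), add_zero, add_zero]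
    rw [mem_box] at ha ⊢
    omega
  have hTG' : TwoState⟦box⟦r + 1 + hF, c + 1, hG, m⟧, W, (r + 1 + hF, c + 1),
      (r + 1 + hF, c + 1 + m - 1), gG⟧ := by
    refine twoState_congr (fun a ha b hb => ?_) hTG
    rw [hW, zF a b (Or.inl ?_), zX a b (Or.inr ⟨ha, hb⟩), zero_add, add_zero]
    rw [mem_box] at ha ⊢
    omega
  -- `W` on darts from the side columns
  have hWside : ∀ u v, u.2 = c ∨ u.2 = c + m + 1 → W u v = X u v := by
    intro u v hu
    rw [hW, zF u v (Or.inl (by rw [mem_box]; omega)), zG u v (Or.inl (by rw [mem_box]; omega)),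
      zero_add, zero_add]
  -- the two unit wires in the side columns (rows `r+2 … r+1+hF`)
  have hwire : ∀ cc, cc = c ∨ cc = c + m + 1 →
      TwoState⟦box⟦r + 2, cc, hF, 1⟧, W, (r + 2, cc), (r + 1 + hF, cc), 1⟧ := by
    intro cc hcc
    have hpath := twoState_path (W := W) (fun i => (r + 2 + i, cc)) (ℓ := 1) (kF - 1)
      (fun i _ j _ h => by
        have := congrArg Prod.fst h
        simp only at this
        omega)
      (by
        rcases hcc with rfl | rfl
        · rw [hWside _ _ (by dsimp only; omega), hWside _ _ (by dsimp only; omega),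
            X7 _ _ (by dsimp only; omega), X7 _ _ (by dsimp only; omega), mul_one]
        · rw [hWside _ _ (by dsimp only; omega), hWside _ _ (by dsimp only; omega),
            X8 _ _ (by dsimp only; omega), X8 _ _ (by dsimp only; omega), mul_one])
      (fun i h1 h2 => by
        rcases hcc with rfl | rfl
        · rw [hWside _ _ (by dsimp only; omega), hWside _ _ (by dsimp only; omega),
            X7 _ _ (by dsimp only; omega), X7 _ _ (by dsimp only; omega), mul_one]
        · rw [hWside _ _ (by dsimp only; omega), hWside _ _ (by dsimp only; omega),
            X8 _ _ (by dsimp only; omega), X8 _ _ (by dsimp only; omega), mul_one])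
      (fun i hi j hj hne => by
        rw [hWside _ _ (by dsimp only; omega)] at hne
        have := hXS _ _ hne
        simp only at this
        omega)
    have himg : (Finset.range (2 * (kF - 1) + 2)).image (fun i => (r + 2 + i, cc)) =
        box⟦r + 2, cc, hF, 1⟧ := by
      ext v
      simp only [Finset.mem_image, Finset.mem_range, mem_box]
      constructor
      · rintro ⟨i, hi, rfl⟩
        simp only
        omega
      · intro hv
        exact ⟨v.1 - (r + 2), by omega, Prod.ext (by simp only; omega) (by simp only; omega)⟩
    rw [himg] at hpath
    simpa only [Nat.add_zero, show r + 2 + (2 * (kF - 1) + 1) = r + 1 + hF by omega] using hpath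
  -- `G` with the two wires: series, series
  have hGw : TwoState⟦(box⟦r + 2, c, hF, 1⟧ ∪ box⟦r + 1 + hF, c + 1, hG, m⟧) ∪ box⟦r + 2, c + m + 1, hF, 1⟧,
      W, (r + 2, c), (r + 2, c + m + 1), 1 * gG * 1⟧ := by
    refine twoState_series (twoState_series (hwire c (Or.inl rfl)) hTG' ?_ ?_ ?_)
      (twoState_swap (hwire (c + m + 1) (Or.inr rfl))) ?_ ?_ ?_
    · rw [Finset.disjoint_left]
      intro a ha hb
      rw [mem_box] at ha hb
      omega
    · intro u hu v hv hne
      rw [mem_box] at hu hv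
      rw [hWside u v (by omega)] at hne
      have := hXS u v hne
      exact ⟨Prod.ext (by simp only; omega) (by simp only; omega),
        Prod.ext (by simp only; omega) (by simp only; omega)⟩
    · rw [hWside _ _ (by dsimp only; omega), hW, zF _ _ (Or.inl (by rw [mem_box]; omega)),
        zG _ _ (Or.inr (by rw [mem_box]; omega)), zero_add, zero_add,
        X9 _ _ (by dsimp only; omega), X9 _ _ (by dsimp only; omega), mul_one]
    · rw [Finset.disjoint_left]
      intro a ha hb
      rw [Finset.mem_union, mem_box, mem_box] at ha
      rw [mem_box] at hb
      omega
    · intro u hu v hv hne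
      rw [Finset.mem_union, mem_box, mem_box] at hu
      rw [mem_box] at hv
      rw [hW, zF u v (Or.inr (by rw [mem_box]; omega)), zG u v (Or.inr (by rw [mem_box]; omega)),
        zero_add, zero_add] at hne
      have := hXS u v hne
      exact ⟨Prod.ext (by simp only; omega) (by simp only; omega),
        Prod.ext (by simp only; omega) (by simp only; omega)⟩
    · rw [hW, zF _ _ (Or.inr (by rw [mem_box]; omega)), zG _ _ (Or.inr (by rw [mem_box]; omega)),
        zero_add, zero_add, hWside (r + 1 + hF, c + m + 1) _ (by dsimp only; omega),
        X10 _ _ (by dsimp only; omega), X10 _ _ (by dsimp only; omega), mul_one]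
  exact ⟨hTF', hGw⟩

end ParWired

end FormulaGridProjection

open Finset FormulaGridProjection in
/-- **Registered sub-goal `stub_formulaGridProjection_frameOffUpper`** of `stub_formulaGridProjection`
(crux stmt-ValiantsHypothesis-5066, line `planar-dimer-sign-elimination`): the frame-and-wire weight
`parX` of the parallel layout vanishes on every dart between two cells of the upper gadget's
rectangle (the frame touches `F` only through its two ports, from outside). [folklore] -/
theorem stub_formulaGridProjection_frameOffUpper : ∀ (R : Type) [CommSemiring R] (ι : Type) (r c hF m : ℕ) (x y : MvPolynomial ι R) (u v : ℕ × ℕ), 2 ≤ hF → 2 ≤ m → u ∈ (Finset.Ico (r + 1) ((r + 1) + hF) ×ˢ Finset.Ico (c + 1) ((c + 1) + m)) → v ∈ (Finset.Ico (r + 1) ((r + 1) + hF) ×ˢ Finset.Ico (c + 1) ((c + 1) + m)) → FormulaGridProjection.parX r c hF m x y u v = 0 :=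
  fun _ _ _ r c hF m x y u v h2F h2m hu hv =>
    (par_prelims (WF := fun _ _ => 0) (WG := fun _ _ => 0) (r := r) (c := c) (hF := hF) (hG := 0)
      (m := m) (x := x) (y := y) (fun _ _ h => absurd rfl h) (fun _ _ h => absurd rfl h) h2F
      h2m).2.2.2.2.2.1 u v (Or.inl ⟨hu, hv⟩)

end Summit.ValiantsHypothesis.ValiantsHypothesis.Theorems.DivisionGapZeroOneTransfer
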